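import Literature.AlgebraicGeometry.Morphisms.SectionsBaseChangeOfFibrewiseVanishingCharts
import Mathlib.AlgebraicGeometry.Fiber
import HarnessLib

/-!
# `H⁰` and base change from fibrewise `H¹`-vanishing — the point form (fibres `p.fiber y`)

[cite: MumfordAV1970, §5, Corollary 3 (p. 53)]
[cite: Hartshorne1977, III Theorem 12.11 (p. 290)]

★ `Morphisms/SectionsBaseChangeOfFibrewiseVanishing` (G8) and ★ `…Charts` (G9) take their fibrewise hypothesis as a
family, indexed by the primes `𝔭` of `A`, of cartesian squares `X_𝔭 → Spec κ(𝔭)` over `Spec κ(𝔭) → Spec A` chosen by the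
consumer, each with `Ext¹(𝒪_{X_𝔭}, G|_{X_𝔭}) = 0`.  This file supplies the canonical choice: Mathlib's scheme-theoretic
fibres `p.fiber y` (`Scheme.Hom.fiber`, a pullback of `p` along `Spec κ(y) → Spec A`), for the points `y` of `Spec A`.
`isPullback_fiberι_SpecMap_algebraMap` re-bases the canonical fibre square on `Spec (y.asIdeal).ResidueField → Spec A`
(Mathlib `Spec.residueFieldIso`, `Scheme.Spec.map_residueFieldIso_inv_eq_fromSpecResidueField`), and the two MAIN THEOREMS
restate G8 and G9 with the hypothesis **`∀ y : Spec A, Ext¹(𝒪_{p.fiber y}, (p.fiberι y)^* G) = 0`**: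
`exists_tensor_secMod_top_linearEquiv_of_forall_fiber` (global-section letters, any affine base change `B′ → Spec A`) and
`exists_tensor_pushforward_linearEquiv_of_forall_fiber` (the chart letters of ★ `Modules/PushforwardBaseChangeCharts(Top)`
at `V = ⊤`).  Theorems only; no instance, notation, named fact.  Universe `Scheme.{0}`.  Cell `hodgecm-mathlib`, F-DAG
(h2) (B-p19 (g15)); HC_CM is proved only modulo the 7 printed citations until rung 0 closes — nothing here bears on a
summit statement.

## References

* D. Mumford, *Abelian Varieties*, TIFR Studies in Mathematics 5 (1970), §5, Cor. 3 (p. 53). [MumfordAV1970]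
* R. Hartshorne, *Algebraic Geometry*, GTM 52 (1977), III Thm. 12.11 (p. 290). [Hartshorne1977]
-/

noncomputable section

set_option backward.isDefEq.respectTransparency false

open CategoryTheory CategoryTheory.Limits CategoryTheory.Abelian Opposite TopologicalSpace AlgebraicGeometry
open TensorProduct

namespace Literature.AlgebraicGeometry.Morphisms

open Literature.AlgebraicGeometry.Modules Literature.AlgebraicGeometry.HodgeTheory Literature.AlgebraicGeometry.Motives

section Points

/-- **The canonical fibre square re-based on `Spec κ(𝔭) → Spec A`**: for a point `y` of `Spec A` (a prime `𝔭 = y.asIdeal`),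
Mathlib's fibre `p.fiber y` with `p.fiberι y : p.fiber y → X` and `p.fiberToSpecResidueField y` followed by
`Spec κ(y) ≅ Spec (y.asIdeal).ResidueField` (`Spec.residueFieldIso`) is cartesian over
`Spec (algebraMap A (y.asIdeal).ResidueField)` — the shape of the fibre data of ★
`exists_tensor_secMod_top_linearEquiv_of_forall_prime`. [cite: Hartshorne1977, III Thm. 12.11 (p. 290), the fibre `X_y`] -/
theorem isPullback_fiberι_SpecMap_algebraMap {A : Type} [CommRing A] {X : Scheme.{0}} (p : X ⟶ Spec (CommRingCat.of A))
    (y : Spec (CommRingCat.of A)) :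
    IsPullback (p.fiberι y) (p.fiberToSpecResidueField y ≫ Spec.map (Scheme.Spec.residueFieldIso (CommRingCat.of A) y).inv) p
      (Spec.map (CommRingCat.ofHom (algebraMap A y.asIdeal.ResidueField))) := by
  have h : IsPullback (p.fiberι y) (p.fiberToSpecResidueField y) p ((Spec (CommRingCat.of A)).fromSpecResidueField y) :=
    IsPullback.of_hasPullback p ((Spec (CommRingCat.of A)).fromSpecResidueField y)
  refine h.of_iso (Iso.refl _) (Iso.refl _) (asIso (Spec.map (Scheme.Spec.residueFieldIso (CommRingCat.of A) y).inv)) (Iso.refl _)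
    (by simp) (by simp) (by simp) ?_
  rw [Iso.refl_hom, Category.comp_id, asIso_hom, Scheme.Spec.map_residueFieldIso_inv_eq_fromSpecResidueField]

/-- **`H⁰` COMMUTES WITH EVERY AFFINE BASE CHANGE, given `H¹`-vanishing on every scheme-theoretic fibre `p.fiber y`**
(★ `exists_tensor_secMod_top_linearEquiv_of_forall_prime` with the canonical fibres): `p : X → Spec A` proper flat, `A`
noetherian, `G` finite locally free with `Ext¹(𝒪_{X_y}, G|_{X_y}) = 0` for every point `y` of `Spec A`; then for every affine
`B′`, every `j : B′ → Spec A` and every cartesian square `X′ = X ×_A B′`,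
`Γ(B′, 𝒪) ⊗_{Γ(Spec A, 𝒪)} Γ(X, G) ≃ Γ(X′, G|_{X′})`, `b ⊗ t ↦ b · η(t)` — and every `Γ(B′)`-linear map with these values is
bijective. [cite: MumfordAV1970, §5 Cor. 3 (p. 53)] [cite: Hartshorne1977, III Thm. 12.11 (p. 290)] -/
theorem exists_tensor_secMod_top_linearEquiv_of_forall_fiber {A : Type} [CommRing A] [IsNoetherianRing A]
    {X : Scheme.{0}} (p : X ⟶ Spec (CommRingCat.of A)) [IsProper p] [Flat p] (G : X.Modules)
    (hL : IsFiniteLocallyFree G)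
    (hvan : ∀ y : Spec (CommRingCat.of A),
      Subsingleton (Ext.{1} (unitModule (p.fiber y)) ((Scheme.Modules.pullback (p.fiberι y)).obj G) 1))
    {X' B' : Scheme.{0}} [IsAffine B'] {g' : X' ⟶ B'} {k : X' ⟶ X} {j : B' ⟶ Spec (CommRingCat.of A)}
    (H : IsPullback k g' p j) :
    letI := (j.appLE ⊤ ⊤ le_top).hom.toAlgebra
    (∃ E : Γ(B', ⊤) ⊗[Γ(Spec (CommRingCat.of A), ⊤)] SecMod G p.appTop.hom ⊤ ≃ₗ[Γ(B', ⊤)]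
        SecMod ((Scheme.Modules.pullback k).obj G) g'.appTop.hom ⊤,
      ∀ (b : Γ(B', ⊤)) (t : SecMod G p.appTop.hom ⊤),
        E (b ⊗ₜ t) = b • SecMod.mk (ρ := g'.appTop.hom) (unitSectionLE k G (V := ⊤) (U := ⊤) le_top
          (SecMod.val (L := G) (ρ := p.appTop.hom) t))) ∧
    ∀ F : Γ(B', ⊤) ⊗[Γ(Spec (CommRingCat.of A), ⊤)] SecMod G p.appTop.hom ⊤ →ₗ[Γ(B', ⊤)]
        SecMod ((Scheme.Modules.pullback k).obj G) g'.appTop.hom ⊤,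
      (∀ (b : Γ(B', ⊤)) (t : SecMod G p.appTop.hom ⊤),
        F (b ⊗ₜ t) = b • SecMod.mk (ρ := g'.appTop.hom) (unitSectionLE k G (V := ⊤) (U := ⊤) le_top
          (SecMod.val (L := G) (ρ := p.appTop.hom) t))) → Function.Bijective F :=
  exists_tensor_secMod_top_linearEquiv_of_forall_prime p G hL
    (fun (𝔭 : Ideal A) _ => p.fiberι (⟨𝔭, inferInstance⟩ : PrimeSpectrum A))
    (fun (𝔭 : Ideal A) _ => p.fiberToSpecResidueField (⟨𝔭, inferInstance⟩ : PrimeSpectrum A) ≫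
      Spec.map (Scheme.Spec.residueFieldIso (CommRingCat.of A) ⟨𝔭, inferInstance⟩).inv)
    (fun (𝔭 : Ideal A) _ => isPullback_fiberι_SpecMap_algebraMap p ⟨𝔭, inferInstance⟩)
    (fun (𝔭 : Ideal A) _ => hvan ⟨𝔭, inferInstance⟩) H

/-- **The chart form with canonical fibres** (★ `exists_tensor_pushforward_linearEquiv_of_forall_prime` with the fibres
`p.fiber y`): for `p : X → Spec A` proper flat, `A` noetherian, `G` finite locally free with `Ext¹(𝒪_{X_y}, G|_{X_y}) = 0` at
every point `y`, a cartesian square `X_T = X ×_A T` and an affine open `W ⊆ T`: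
`Γ(T, W) ⊗_{Γ(Spec A, 𝒪)} Γ(p_* G, ⊤) ≃ Γ((p_T)_*(pr^* G), W)`, `t ⊗ s ↦ t · η_{pr}(s)|`, and every `Γ(T, W)`-linear map with
these values is bijective (the clause ★ `Modules.isIso_pushforwardBaseChangeHom_of_forall_bijective_top` eats).
[cite: MumfordAV1970, §5 Cor. 3 (p. 53)] [cite: Hartshorne1977, III Thm. 12.11 (p. 290)] -/
theorem exists_tensor_pushforward_linearEquiv_of_forall_fiber {A : Type} [CommRing A] [IsNoetherianRing A]
    {X : Scheme.{0}} (p : X ⟶ Spec (CommRingCat.of A)) [IsProper p] [Flat p] (G : X.Modules)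
    (hL : IsFiniteLocallyFree G)
    (hvan : ∀ y : Spec (CommRingCat.of A),
      Subsingleton (Ext.{1} (unitModule (p.fiber y)) ((Scheme.Modules.pullback (p.fiberι y)).obj G) 1))
    {T XT : Scheme.{0}} {pr : XT ⟶ X} {pT : XT ⟶ T} {b : T ⟶ Spec (CommRingCat.of A)}
    (H : IsPullback pr pT p b) (W : T.Opens) (hW : IsAffineOpen W) :
    letI := (b.appLE ⊤ W le_top).hom.toAlgebra
    (∃ e : Γ(T, W) ⊗[Γ(Spec (CommRingCat.of A), ⊤)] Γ((Scheme.Modules.pushforward p).obj G, ⊤) ≃ₗ[Γ(T, W)]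
        Γ((Scheme.Modules.pushforward pT).obj ((Scheme.Modules.pullback pr).obj G), W),
      ∀ (t : Γ(T, W)) (s : Γ(G, p ⁻¹ᵁ ⊤)),
        e (t ⊗ₜ (show Γ((Scheme.Modules.pushforward p).obj G, ⊤) from s)) =
          t • (show Γ((Scheme.Modules.pushforward pT).obj ((Scheme.Modules.pullback pr).obj G), W) from
            unitSectionLE pr G ((Scheme.Hom.preimage_mono pT le_top).trans (preimage_preimage_eq_of_sq H.w ⊤).ge) s)) ∧
    ∀ F : Γ(T, W) ⊗[Γ(Spec (CommRingCat.of A), ⊤)] Γ((Scheme.Modules.pushforward p).obj G, ⊤) →ₗ[Γ(T, W)]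
        Γ((Scheme.Modules.pushforward pT).obj ((Scheme.Modules.pullback pr).obj G), W),
      (∀ (t : Γ(T, W)) (s : Γ(G, p ⁻¹ᵁ ⊤)),
        F (t ⊗ₜ (show Γ((Scheme.Modules.pushforward p).obj G, ⊤) from s)) =
          t • (show Γ((Scheme.Modules.pushforward pT).obj ((Scheme.Modules.pullback pr).obj G), W) from
            unitSectionLE pr G ((Scheme.Hom.preimage_mono pT le_top).trans (preimage_preimage_eq_of_sq H.w ⊤).ge) s)) →
      Function.Bijective F :=
  exists_tensor_pushforward_linearEquiv_of_forall_prime p G hL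
    (fun (𝔭 : Ideal A) _ => p.fiberι (⟨𝔭, inferInstance⟩ : PrimeSpectrum A))
    (fun (𝔭 : Ideal A) _ => p.fiberToSpecResidueField (⟨𝔭, inferInstance⟩ : PrimeSpectrum A) ≫
      Spec.map (Scheme.Spec.residueFieldIso (CommRingCat.of A) ⟨𝔭, inferInstance⟩).inv)
    (fun (𝔭 : Ideal A) _ => isPullback_fiberι_SpecMap_algebraMap p ⟨𝔭, inferInstance⟩)
    (fun (𝔭 : Ideal A) _ => hvan ⟨𝔭, inferInstance⟩) H W hW

end Points

end Literature.AlgebraicGeometry.Morphisms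

end
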